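import Mathlib
import Summits.Ventures.PercRepro.TriangleCapFourRowTwoSecondBest

/-!
# PercRepro — THE NON-BIPARTITE STABILITY TABLE ON EVERY CELL WITH `r ≤ 2`: the maximum of `Σ_v d(v)²` over the
`K₄⁻`-free graphs on `Fin k` with `a (k − a) − r` edges that are NOT `a`-bipartite is EXACTLY
`m k − r (k − 1 − r) − nonbipGap k a r`, with `nonbipGap = B2 = 2 (k − 2a − 1)(a − r)` where the one-triangle
family does not exist (`r ≤ a − 3`), `T = 2 (k − 7)` on the row `a = 3` at `r = 1, 2`, and `T = 2k − 18` on the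
cell `(k, 4, 2)` (p3, gen 45; part 203)

The bounds: parts 195–196 (`diag_second_order_all`, `below_second_order_gen`), part 190
(`three_row_second_order_pos`), part 198 (`four_two_second_order`). The witnesses: the other bipartition
`K_{a+1,k−a−1}` minus a star (`other_bipartition_value`), which is not `a`-bipartite because an `a`-bipartite graph
with `r ≤ 2` missing pairs is at most `2` below the closed form (`bipSub_ge_of_le_two`: the missing graph has
`Σ d² ≥ Σ d = 2r`) while `B2 ≥ 6`; the family `T` (`tFamily`, `tFamilyGen`), `BipSub` for no `A`. Axioms: standard.
-/

namespace PercRepro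

namespace TriangleCap

namespace C047

open Finset

variable {V : Type*} [Fintype V] [DecidableEq V]

/-- **AN `a`-BIPARTITE GRAPH WITH `r ≤ 2` MISSING PAIRS IS AT MOST `2` BELOW THE CLOSED FORM:** `BipSub D A`, `|A| = a`,
`m + r = a (k − a)`, `r ≤ 2`, `r + 1 ≤ k` ⇒ `m k ≤ Σ_v d(v)² + r (k − 1 − r) + 2`. -/
theorem bipSub_ge_of_le_two (D : SimpleGraph V) [DecidableRel D.Adj] (A : Finset V) (hD : BipSub D A) (a r : ℕ)
    (hA : A.card = a) (hm : D.edgeFinset.card + r = a * (Fintype.card V - a)) (hr : r ≤ 2)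
    (hk : r + 1 ≤ Fintype.card V) :
    D.edgeFinset.card * Fintype.card V ≤ ∑ v, deg D v * deg D v + r * (Fintype.card V - 1 - r) + 2 := by
  have key := sum_deg_sq_bipSub D A hD
  have hM := card_edges_missingGraph D A hD a r hA hm
  rw [hM, hA] at key
  -- the missing graph has `Σ d² ≥ Σ d = 2r`
  have hH : 2 * r ≤ ∑ v, deg (missingGraph D A) v * deg (missingGraph D A) v := by
    have h1 : ∑ v, deg (missingGraph D A) v ≤ ∑ v, deg (missingGraph D A) v * deg (missingGraph D A) v :=
      sum_le_sum (fun v _ => Nat.le_mul_self _)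
    rw [sum_deg_eq, hM] at h1
    exact h1
  obtain ⟨k, hk'⟩ : ∃ k, Fintype.card V = k := ⟨_, rfl⟩
  obtain ⟨m, hmdef⟩ : ∃ m, D.edgeFinset.card = m := ⟨_, rfl⟩
  obtain ⟨S, hS⟩ : ∃ S, ∑ v, deg D v * deg D v = S := ⟨_, rfl⟩
  obtain ⟨H, hHdef⟩ : ∃ H, ∑ v, deg (missingGraph D A) v * deg (missingGraph D A) v = H := ⟨_, rfl⟩
  rw [hk'] at key hm hk
  rw [hS, hHdef] at key
  rw [hHdef] at hH
  rw [hmdef] at hm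
  rw [hS, hk', hmdef]
  have hmk : a * (k - a) * k = m * k + r * k := by rw [← add_mul, hm]
  rw [hmk] at key
  interval_cases r
  · omega
  · have e : k - 1 - 1 = k - 2 := by omega
    rw [e]
    omega
  · have e : k - 1 - 2 = k - 3 := by omega
    rw [e]
    omega

/-- The non-bipartite gap of the stability table on the cells `r ≤ 2`: `B2 = 2 (k − 2a − 1)(a − r)` where the
family `T` does not exist (`r ≤ a − 3`), `T = 2 (k − 7)` on the row `a = 3`, `T = 2k − 18` on `(k, 4, 2)`. -/
def nonbipGap (k a r : ℕ) : ℕ :=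
  if r + 3 ≤ a then 2 * (k - 2 * a - 1) * (a - r) else if a = 3 then 2 * (k - 7) else 2 * (k - 9)

/-- **THE NON-BIPARTITE STABILITY TABLE ON EVERY CELL WITH `r ≤ 2`:** for `3 ≤ a`, `r ≤ 2`, `2a + 2 ≤ k`
(`r + 7 ≤ k` on the row `a = 3`), every `K₄⁻`-free graph on `Fin k` with `a (k − a) − r` edges that is not a
spanning subgraph of any `K(A, Aᶜ)` with `|A| = a` has `Σ_v d(v)² + r (k − 1 − r) + nonbipGap k a r ≤ m k`, and the
value is attained by a non-`a`-bipartite graph. -/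
theorem nonbip_second_best_table (k a r : ℕ) (ha : 3 ≤ a) (hr : r ≤ 2) (hk : 2 * a + 2 ≤ k)
    (hk3 : a = 3 → r + 7 ≤ k) :
    (∀ (D : SimpleGraph (Fin k)) [DecidableRel D.Adj], K4mFree D → D.edgeFinset.card + r = a * (k - a) →
        (¬ ∃ A : Finset (Fin k), A.card = a ∧ BipSub D A) →
        ∑ v, deg D v * deg D v + r * (k - 1 - r) + nonbipGap k a r ≤ D.edgeFinset.card * k) ∧
      ∃ (D : SimpleGraph (Fin k)) (_ : DecidableRel D.Adj), K4mFree D ∧ D.edgeFinset.card + r = a * (k - a) ∧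
        (¬ ∃ A : Finset (Fin k), A.card = a ∧ BipSub D A) ∧
        ∑ v, deg D v * deg D v + r * (k - 1 - r) + nonbipGap k a r = D.edgeFinset.card * k := by
  have hcard : Fintype.card (Fin k) = k := Fintype.card_fin k
  by_cases hB2 : r + 3 ≤ a
  · -- the family `T` does not exist: `B2`
    have hgap : nonbipGap k a r = 2 * (k - 2 * a - 1) * (a - r) := by simp [nonbipGap, hB2]
    rw [hgap]
    refine ⟨?_, ?_⟩
    · intro D _ hK hm hnb
      rcases Nat.eq_zero_or_pos r with hr0 | hrpos
      · subst hr0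
        rcases diag_second_order_all D hK a ha (by rw [hcard]; omega) (by rw [hcard]; simpa using hm)
          with h | h
        · exact absurd h hnb
        · rw [hcard] at h
          have e : 2 * a * (k - 2 * a - 1) = 2 * (k - 2 * a - 1) * (a - 0) := by
            rw [Nat.sub_zero]; ring
          rw [e] at h
          simpa using h
      · rcases below_second_order_gen D hK a r (by omega) hr hB2 (by rw [hcard]; omega)
          (by rw [hcard]; exact hm) with h | h
        · exact absurd h hnb
        · rw [hcard] at h
          exact h
    · obtain ⟨D, inst, hK, hE, hS⟩ := other_bipartition_value k a r (by omega) (by omega) hk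
      obtain ⟨P, hP⟩ : ∃ P, a * (k - a) = P := ⟨_, rfl⟩
      have hpos : r ≤ P := by
        have : 3 ≤ k - a := by omega
        calc r ≤ 3 := by omega
          _ ≤ 1 * 3 := by norm_num
          _ ≤ a * (k - a) := Nat.mul_le_mul (by omega) this
          _ = P := hP
      rw [hP] at hE hS
      rw [← hE] at hS
      have hE' : D.edgeFinset.card + r = a * (k - a) := by rw [hP]; omega
      refine ⟨D, inst, hK, hE', ?_, hS⟩
      rintro ⟨A, hAcard, hA⟩
      have hlow := bipSub_ge_of_le_two D A hA a r hAcard (by rw [hcard]; exact hE') hr (by rw [hcard]; omega)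
      rw [hcard] at hlow
      have hB : 6 ≤ 2 * (k - 2 * a - 1) * (a - r) := by
        have h1 : 1 ≤ k - 2 * a - 1 := by omega
        have h2 : 3 ≤ a - r := by omega
        nlinarith
      omega
  · -- the family `T`: the row `a = 3` (`r = 1, 2`) or the cell `(k, 4, 2)`
    rcases Nat.lt_or_ge a 4 with ha3 | ha4
    · have ha3' : a = 3 := by omega
      subst ha3'
      have hr1 : 1 ≤ r := by omega
      have hk7 := hk3 rfl
      have hgap : nonbipGap k 3 r = 2 * (k - 7) := by simp [nonbipGap, hB2]
      rw [hgap]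
      refine ⟨?_, ?_⟩
      · intro D _ hK hm hnb
        have h := three_row_second_order_pos D hK r hr1 (by rw [hcard]; exact hk7)
          (by rw [hcard]; omega) hnb
        rw [hcard] at h
        exact h
      · obtain ⟨n, rfl⟩ : ∃ n, k = n + 1 := ⟨k - 1, by omega⟩
        obtain ⟨hK, hE, hS, hnb⟩ := tFamily_value n r hr1 (by omega)
        rw [hcard] at hE hS
        refine ⟨tFamily n r (by omega), inferInstance, hK, by omega, ?_, hS⟩
        rintro ⟨A, -, hA⟩
        exact hnb A hA
    · have ha4' : a = 4 := by omega
      have hr2 : r = 2 := by omega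
      subst ha4' hr2
      have hgap : nonbipGap k 4 2 = 2 * (k - 9) := by simp [nonbipGap]
      rw [hgap]
      exact four_two_nonbip_second_best k (by omega)

end C047

end TriangleCap

end PercRepro
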